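import Literature.NumberTheory.DiophantineGeometry.EntireContinuation
import HarnessLib

/-!
# Entire continuation from a half-plane: the predicate is proper

`Literature.NumberTheory.DiophantineGeometry.LFunction.HasEntireContinuationFrom c f`
(`EntireContinuation.lean`) is a *predicate* in the abscissa `c : ℝ` and the function
`f : ℂ → ℂ` (its binders come from a `variable` line), i.e. a definition, not a closed named
fact: there is no `HasEntireContinuationFrom_holds` to land. This file records, sorry-free, the
two facts that pin this down:

* `hasEntireContinuationFrom_of_differentiable`: an entire `f` is its own continuation, and then
  `entireContinuationFrom c f = f` (`entireContinuationFrom_eq_self`) — the predicate is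
  inhabited;
* `not_hasEntireContinuationFrom_inv_sub`: `s ↦ (s - c)⁻¹` has **no** entire continuation from
  `re s > c` (if `g` were one, `s ↦ g s * (s - c)` is entire and `= 1` on the half-plane, hence
  `= 1` on `ℂ` by the identity theorem, but it vanishes at `s = c`), so the universal closure
  `∀ c f, HasEntireContinuationFrom c f` is false (`not_forall_hasEntireContinuationFrom`).

Standard complex analysis (identity theorem, Mathlib `AnalyticOnNhd.eq_of_eventuallyEq`);
no new definitions, no named facts.

## References

* J. Neukirch, *Algebraic Number Theory*, Ch. VII §5 (analytic continuation of L-series).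
* L. Ahlfors, *Complex Analysis*, 3rd ed., Ch. 4 §3.2 (identity theorem). [folklore]
-/

noncomputable section

open Complex Filter Topology

namespace Literature.NumberTheory.DiophantineGeometry

namespace LFunction

variable {c : ℝ} {f : ℂ → ℂ}

/-- An entire function is an entire continuation of itself from every half-plane `re s > c`.
[folklore] -/
theorem hasEntireContinuationFrom_of_differentiable (c : ℝ) (hf : Differentiable ℂ f) :
    HasEntireContinuationFrom c f :=
  ⟨f, hf, fun _ _ => rfl⟩

/-- For an entire `f`, the chosen continuation `entireContinuationFrom c f` *is* `f`
(uniqueness of the continuation, identity theorem). [folklore] -/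
theorem entireContinuationFrom_eq_self (c : ℝ) (hf : Differentiable ℂ f) :
    entireContinuationFrom c f = f :=
  entireContinuationFrom_eq_of_mem ⟨hf, fun _ _ => rfl⟩

/-- The function `s ↦ (s - c)⁻¹` (holomorphic on `re s > c`, pole at `s = c`) admits no entire
continuation from the half-plane `re s > c`: if `g` were one, `s ↦ g s * (s - c)` would be an
entire function equal to `1` on the half-plane, hence equal to `1` everywhere (identity
theorem), yet it vanishes at `s = c`. In particular `HasEntireContinuationFrom` is a proper
predicate, not a universally valid statement. [folklore] -/
theorem not_hasEntireContinuationFrom_inv_sub (c : ℝ) :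
    ¬ HasEntireContinuationFrom c (fun s => (s - c)⁻¹) := by
  rintro ⟨g, hg, hgf⟩
  have hh : Differentiable ℂ (fun s => g s * (s - c)) :=
    hg.mul (differentiable_id.sub (differentiable_const _))
  have hopen : IsOpen {s : ℂ | c < s.re} := isOpen_lt continuous_const Complex.continuous_re
  have key : (fun s => g s * (s - c)) = fun _ => (1 : ℂ) := by
    refine AnalyticOnNhd.eq_of_eventuallyEq (z₀ := ((c : ℂ) + 1))
      (hh.differentiableOn.analyticOnNhd isOpen_univ) analyticOnNhd_const ?_
    filter_upwards [hopen.mem_nhds (show c < ((c : ℂ) + 1).re by simp)] with s hs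
    have hs0 : s - (c : ℂ) ≠ 0 := by
      intro h0
      rw [sub_eq_zero] at h0
      rw [h0, Complex.ofReal_re] at hs
      exact lt_irrefl c hs
    rw [hgf s hs, inv_mul_cancel₀ hs0]
  have h1 := congr_fun key (c : ℂ)
  simp only [sub_self, mul_zero] at h1
  exact zero_ne_one h1

/-- The universal closure of the predicate `HasEntireContinuationFrom` is false: not every
`f : ℂ → ℂ` has an entire continuation from a half-plane (witness `c = 0`, `f s = s⁻¹`,
`not_hasEntireContinuationFrom_inv_sub`). Hence the predicate is a definition to be *assumed*
of a given L-function (`(h : HasEntireContinuationFrom c f)`), never a dischargeable fact.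
[folklore] -/
theorem not_forall_hasEntireContinuationFrom :
    ¬ ∀ (c : ℝ) (f : ℂ → ℂ), HasEntireContinuationFrom c f :=
  fun h => not_hasEntireContinuationFrom_inv_sub 0 (h 0 _)

/-- For every abscissa `c` some `f : ℂ → ℂ` has no entire continuation from `re s > c`
(witness `f s = (s - c)⁻¹`). [folklore] -/
theorem exists_not_hasEntireContinuationFrom (c : ℝ) :
    ∃ f : ℂ → ℂ, ¬ HasEntireContinuationFrom c f :=
  ⟨_, not_hasEntireContinuationFrom_inv_sub c⟩

end LFunction

end Literature.NumberTheory.DiophantineGeometry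

end
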